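import Summits.NavierStokesRegularity.NavierStokesRegularity.Theorems.ExtremiserTransienceTwoThirdsPieceIntegrals
import HarnessLib

/-!
# Route `ExtremiserTransience`, crux `NearExtremalTransiencePerFlow` (stmt-NavierStokesRegularity-26567),
# LINE g10-1 «two_thirds» (ns-idea-10), stub S1a′ — BRICK 2, lemma P3e: THE LOCALISED SHARP INEQUALITY WITH EXCESS (one piece)

`--supports stmt-NavierStokesRegularity-26567` (helper; prover seat ns-net-p2 g13).  κ⋆-universality (`sharpDepletion_is_universal`) applied to
an admissible piece `φ` of `w` (smooth, compactly supported, divergence free, height `≤ 1 + m`) whose offsets against the weight `χ` of the cell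
`B = B(c,R)` have the structure of `…TwoThirdsPieceIntegrals` gives the LOCALISED SHARP INEQUALITY WITH EXCESS, in LINEAR form
(`piece_excess`): for every `t ∈ (0,1]`,

  `J_B − κ⋆√(Z_B W_B) ≤ κ⋆·((m/2)(Z_B + P + W_B + Q) + (t/2)(Z_B + W_B) + (1/(2t) + 1/2)(P + Q)) + 2A₁Z_L + 2A₁j₁ + m₃(Z_B + P)`,

`P = 2Z_L + 2j₁`, `Q = 2W_L + 6j₂`.  Ingredients: `test_field_admissible` (a `C^∞_c` divergence-free field is in κ⋆'s class), `Jst_le_sharp`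
(`J(φ) ≤ κ⋆ M √Z(φ) √W(φ)`), the elementary `sqrt_add_mul_sqrt_add_le` (AM–GM with a free parameter `t`, which the τ-average later takes
`≍ ρ^{-1/2}`) and `excess_algebra`.  HONEST FRAMING: nothing about Navier–Stokes is proved; no summit is proved by a line. [folklore]
-/

noncomputable section

open scoped Topology InnerProductSpace RealInnerProductSpace ENNReal NNReal ContDiff
open MeasureTheory Filter Set Metric
open Literature.Analysis.FluidPDE
open Summit.NavierStokesRegularity.NavierStokesRegularity.Theorems.DepletionLadder.KStar.HalfSpace
open Summit.NavierStokesRegularity.NavierStokesRegularity.Theorems.DepletionLadder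
open Summit.NavierStokesRegularity.NavierStokesRegularity.Theorems.NearExtremalTransiencePerFlow.LocalMaximiser

namespace Summit.NavierStokesRegularity.NavierStokesRegularity.Theorems.NearExtremalTransiencePerFlow.TwoThirds

-- the summit's namespace repeats the problem name by convention (D-0017)
set_option linter.dupNamespace false

/-! ## Elementary inequalities -/

/-- **AM–GM with a free parameter**: `√(Z+P)·√(W+Q) ≤ √Z·√W + (t/2)(Z+W) + (1/(2t) + 1/2)(P+Q)`. [folklore] -/
theorem sqrt_add_mul_sqrt_add_le {Z W P Q t : ℝ} (hZ : 0 ≤ Z) (hW : 0 ≤ W) (hP : 0 ≤ P) (hQ : 0 ≤ Q) (ht : 0 < t) :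
    Real.sqrt (Z + P) * Real.sqrt (W + Q) ≤
      Real.sqrt Z * Real.sqrt W + t / 2 * (Z + W) + (1 / (2 * t) + 1 / 2) * (P + Q) := by
  -- `√(a+b) ≤ √a + √b` (also in the tree as `Literature.NumberTheory.LFunctions.MRT2015.sqrt_add_le_sqrt_add_sqrt`)
  have sadd : ∀ {a b : ℝ}, 0 ≤ a → 0 ≤ b → Real.sqrt (a + b) ≤ Real.sqrt a + Real.sqrt b := by
    intro a b ha hb
    have h0 : 0 ≤ Real.sqrt a + Real.sqrt b := by positivity
    calc Real.sqrt (a + b) ≤ Real.sqrt ((Real.sqrt a + Real.sqrt b) ^ 2) :=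
          Real.sqrt_le_sqrt (by nlinarith only [Real.sq_sqrt ha, Real.sq_sqrt hb, Real.sqrt_nonneg a, Real.sqrt_nonneg b])
      _ = Real.sqrt a + Real.sqrt b := Real.sqrt_sq h0
  -- weighted AM–GM `√a√b ≤ (s a + b/s)/2`
  have wamgm : ∀ {a b s : ℝ}, 0 ≤ a → 0 ≤ b → 0 < s → Real.sqrt a * Real.sqrt b ≤ (s * a + b / s) / 2 := by
    intro a b s ha hb hs
    have key : 2 * s * (Real.sqrt a * Real.sqrt b) ≤ s ^ 2 * a + b := by
      nlinarith only [sq_nonneg (s * Real.sqrt a - Real.sqrt b), Real.sq_sqrt ha, Real.sq_sqrt hb]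
    rw [le_div_iff₀ (by norm_num : (0 : ℝ) < 2)]
    have h2 : Real.sqrt a * Real.sqrt b * 2 = (2 * s * (Real.sqrt a * Real.sqrt b)) / s := by field_simp
    have h3 : s * a + b / s = (s ^ 2 * a + b) / s := by field_simp
    rw [h2, h3]
    exact div_le_div_of_nonneg_right key hs.le
  have h1 : Real.sqrt (Z + P) ≤ Real.sqrt Z + Real.sqrt P := sadd hZ hP
  have h2 : Real.sqrt (W + Q) ≤ Real.sqrt W + Real.sqrt Q := sadd hW hQ
  have h3 : Real.sqrt (Z + P) * Real.sqrt (W + Q) ≤ (Real.sqrt Z + Real.sqrt P) * (Real.sqrt W + Real.sqrt Q) :=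
    mul_le_mul h1 h2 (Real.sqrt_nonneg _) (by positivity)
  have a1 : Real.sqrt Z * Real.sqrt Q ≤ (t * Z + Q / t) / 2 := wamgm hZ hQ ht
  have a2 : Real.sqrt W * Real.sqrt P ≤ (t * W + P / t) / 2 := wamgm hW hP ht
  have a3 : Real.sqrt P * Real.sqrt Q ≤ (1 * P + Q / 1) / 2 := wamgm hP hQ one_pos
  have e : (Real.sqrt Z + Real.sqrt P) * (Real.sqrt W + Real.sqrt Q) =
      Real.sqrt Z * Real.sqrt W + Real.sqrt Z * Real.sqrt Q + Real.sqrt W * Real.sqrt P + Real.sqrt P * Real.sqrt Q := by ring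
  have e2 : (t * Z + Q / t) / 2 + (t * W + P / t) / 2 + (1 * P + Q / 1) / 2 =
      t / 2 * (Z + W) + (1 / (2 * t) + 1 / 2) * (P + Q) := by
    field_simp
    ring
  linarith only [h3, e, a1, a2, a3, e2]

/-- **The excess algebra**: from the sharp inequality for the piece and the comparisons `Z' ≤ Z_B + P`, `W' ≤ W_B + Q`,
`J_B − X − m₃Z' ≤ J'`, the linear excess bound. [folklore] -/
theorem excess_algebra {κ m m₃ t J' Z' W' Zb Wb P Q Jb X : ℝ} (hκ : 0 ≤ κ) (hm : 0 ≤ m) (hm₃ : 0 ≤ m₃) (ht : 0 < t)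
    (hZb : 0 ≤ Zb) (hWb : 0 ≤ Wb) (hP : 0 ≤ P) (hQ : 0 ≤ Q)
    (hsharp : J' ≤ κ * (1 + m) * Real.sqrt Z' * Real.sqrt W') (hZle : Z' ≤ Zb + P) (hWle : W' ≤ Wb + Q)
    (hJ : Jb - X - m₃ * Z' ≤ J') :
    Jb - κ * Real.sqrt (Zb * Wb) ≤
      κ * (m / 2 * (Zb + P + Wb + Q) + t / 2 * (Zb + Wb) + (1 / (2 * t) + 1 / 2) * (P + Q)) + X + m₃ * (Zb + P) := by
  have hmono : Real.sqrt Z' * Real.sqrt W' ≤ Real.sqrt (Zb + P) * Real.sqrt (Wb + Q) :=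
    mul_le_mul (Real.sqrt_le_sqrt hZle) (Real.sqrt_le_sqrt hWle) (Real.sqrt_nonneg _) (Real.sqrt_nonneg _)
  have hS := sqrt_add_mul_sqrt_add_le hZb hWb hP hQ ht
  have hamgm : Real.sqrt (Zb + P) * Real.sqrt (Wb + Q) ≤ ((Zb + P) + (Wb + Q)) / 2 := by
    nlinarith only [sq_nonneg (Real.sqrt (Zb + P) - Real.sqrt (Wb + Q)), Real.sq_sqrt (by positivity : 0 ≤ Zb + P),
      Real.sq_sqrt (by positivity : 0 ≤ Wb + Q)]
  have hprod : Real.sqrt (Zb * Wb) = Real.sqrt Zb * Real.sqrt Wb := Real.sqrt_mul hZb Wb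
  rw [hprod]
  have e1 : κ * (1 + m) * Real.sqrt Z' * Real.sqrt W' = κ * (Real.sqrt Z' * Real.sqrt W') + κ * m * (Real.sqrt Z' * Real.sqrt W') := by ring
  have u1 : κ * (Real.sqrt Z' * Real.sqrt W') ≤ κ * (Real.sqrt Zb * Real.sqrt Wb + t / 2 * (Zb + Wb) + (1 / (2 * t) + 1 / 2) * (P + Q)) :=
    mul_le_mul_of_nonneg_left (hmono.trans hS) hκ
  have u2 : κ * m * (Real.sqrt Z' * Real.sqrt W') ≤ κ * m * (((Zb + P) + (Wb + Q)) / 2) :=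
    mul_le_mul_of_nonneg_left (hmono.trans hamgm) (mul_nonneg hκ hm)
  have u3 : m₃ * Z' ≤ m₃ * (Zb + P) := mul_le_mul_of_nonneg_left hZle hm₃
  linarith only [hsharp, hJ, e1, u1, u2, u3]

/-! ## Test fields are admissible for κ⋆ -/

section Test

variable {φ : E3 → E3}

/-- A smooth compactly supported field has a bounded gradient and `D⁰, D¹, D² ∈ L²`. [folklore] -/
theorem test_field_admissible (hφ : ContDiff ℝ (⊤ : ℕ∞) φ) (hφc : HasCompactSupport φ) :
    (∃ B : ℝ, ∀ x, ‖fderiv ℝ φ x‖ ≤ B) ∧ (∫⁻ x, ‖iteratedFDeriv ℝ 0 φ x‖ₑ ^ 2 < ⊤) ∧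
      (∫⁻ x, ‖iteratedFDeriv ℝ 1 φ x‖ₑ ^ 2 < ⊤) ∧ (∫⁻ x, ‖iteratedFDeriv ℝ 2 φ x‖ₑ ^ 2 < ⊤) := by
  have hk : ∀ k : ℕ, ∫⁻ x, ‖iteratedFDeriv ℝ k φ x‖ₑ ^ 2 < ⊤ := by
    intro k
    have hc : Continuous (iteratedFDeriv ℝ k φ) := hφ.continuous_iteratedFDeriv (by exact_mod_cast le_top)
    have h2 : MemLp (iteratedFDeriv ℝ k φ) 2 (volume : Measure (EuclideanSpace ℝ (Fin 3))) :=
      hc.memLp_of_hasCompactSupport (hφc.iteratedFDeriv (𝕜 := ℝ) k)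
    exact KStar.lintegral_enorm_sq_lt_top_iff_eLpNorm.2 h2.2
  obtain ⟨C, hC⟩ := (hφ.continuous_fderiv (by simp)).bounded_above_of_compact_support (hφc.fderiv (𝕜 := ℝ))
  exact ⟨⟨C, hC⟩, hk 0, hk 1, hk 2⟩

/-- **Sharp inequality for a test piece**: `J(φ) ≤ κ⋆ M √Z(φ) √W(φ)` for a smooth compactly supported divergence-free `φ` with `‖φ‖ ≤ M`. [folklore] -/
theorem Jst_le_sharp (hφ : ContDiff ℝ (⊤ : ℕ∞) φ) (hφc : HasCompactSupport φ) (hdiv : VectorCalculus.IsDivFree φ) {M : ℝ}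
    (hM : ∀ x, ‖φ x‖ ≤ M) : Jst φ ≤ kStar * M * Real.sqrt (Zen φ) * Real.sqrt (Wpa φ) := by
  obtain ⟨⟨B, hB⟩, h0, h1, h2⟩ := test_field_admissible hφ hφc
  have h := sharpDepletion_is_universal φ M B hφ hdiv hM hB h0 h1 h2
  exact (le_abs_self _).trans h

end Test

/-! ## The localised sharp inequality with excess -/

section Excess

variable {w φ : E3 → E3} {χ : E3 → ℝ} {c : E3} {R ℓ A₁ m m₃ j₁ j₂ : ℝ}

/-- **THE LOCALISED SHARP INEQUALITY WITH EXCESS (one piece, linear form).**  See the module docstring. [folklore] -/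
theorem piece_excess (hw : ContDiff ℝ (⊤ : ℕ∞) w) (hDw : ∀ x, ‖fderiv ℝ w x‖ ≤ A₁)
    (h1 : ∫⁻ x, ‖iteratedFDeriv ℝ 1 w x‖ₑ ^ 2 < ⊤) (h2 : ∫⁻ x, ‖iteratedFDeriv ℝ 2 w x‖ₑ ^ 2 < ⊤)
    (hφ : ContDiff ℝ (⊤ : ℕ∞) φ) (hφc : HasCompactSupport φ) (hφdiv : VectorCalculus.IsDivFree φ)
    (hm : 0 ≤ m) (hM : ∀ x, ‖φ x‖ ≤ 1 + m) (hℓ : 0 ≤ ℓ)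
    (hχc : Continuous χ) (hχ01 : ∀ x, 0 ≤ χ x ∧ χ x ≤ 1) (hone : ∀ x ∈ ball c R, χ x = 1)
    (hχout : ∀ x, x ∉ ball c (R + ℓ) → χ x = 0)
    (he1 : ∀ x, x ∉ ball c (R + ℓ) \ ball c R → curl φ x - χ x • curl w x = 0)
    (hi1 : Integrable fun x => ‖curl φ x - χ x • curl w x‖ ^ 2) (hj₁ : ∫ x, ‖curl φ x - χ x • curl w x‖ ^ 2 ≤ j₁)
    (he2 : ∀ x, x ∉ ball c (R + ℓ) \ ball c R → fderiv ℝ (curl φ) x - χ x • fderiv ℝ (curl w) x = 0)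
    (hi2 : Integrable fun x => ‖fderiv ℝ (curl φ) x - χ x • fderiv ℝ (curl w) x‖ ^ 2)
    (hj₂ : ∫ x, ‖fderiv ℝ (curl φ) x - χ x • fderiv ℝ (curl w) x‖ ^ 2 ≤ j₂)
    (hm₃ : 0 ≤ m₃) (he3 : ∀ x, ‖fderiv ℝ φ x - χ x • fderiv ℝ w x‖ ≤ m₃) {t : ℝ} (ht : 0 < t) :
    Jb w c R - kStar * Real.sqrt (Zb w c R * Wb w c R) ≤
      kStar * (m / 2 * (Zb w c R + (2 * (Zb w c (R + ℓ) - Zb w c R) + 2 * j₁) + Wb w c R + (2 * (Wb w c (R + ℓ) - Wb w c R) + 6 * j₂)) +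
        t / 2 * (Zb w c R + Wb w c R) +
        (1 / (2 * t) + 1 / 2) * ((2 * (Zb w c (R + ℓ) - Zb w c R) + 2 * j₁) + (2 * (Wb w c (R + ℓ) - Wb w c R) + 6 * j₂))) +
      (2 * A₁ * (Zb w c (R + ℓ) - Zb w c R) + 2 * A₁ * j₁) +
      m₃ * (Zb w c R + (2 * (Zb w c (R + ℓ) - Zb w c R) + 2 * j₁)) := by
  have hw2 : ContDiff ℝ 2 w := hw.of_le (by norm_cast)
  have hw3 : ContDiff ℝ 3 w := hw.of_le (by norm_cast)
  have hφ1 : ContDiff ℝ 1 φ := hφ.of_le (by norm_cast)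
  have hφ2 : ContDiff ℝ 2 φ := hφ.of_le (by norm_cast)
  have hZ := Zen_piece_le hw2 h1 hφ1 hφc hℓ hχ01 hχout he1 hi1 hj₁
  have hW := Wpa_piece_le hw3 h2 hφ2 hφc hℓ hχ01 hχout he2 hi2 hj₂
  have hJ := Jst_piece_ge hw hDw h1 hφ hφc hℓ hχc hχ01 hone hχout he1 hi1 hj₁ he3
  have hsharp := Jst_le_sharp hφ hφc hφdiv hM
  -- signs
  have izd : Integrable (zd w) := (integrable_norm_curl_sq hw2 h1).1
  have iwd : Integrable (wd w) := (integrable_frobeniusNormSq_fderiv_curl hw3 h2).1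
  have hZb0 : 0 ≤ Zb w c R := Zb_nonneg w c R
  have hWb0 : 0 ≤ Wb w c R := Wb_nonneg w c R
  have hsub : ball c R ⊆ ball c (R + ℓ) := ball_subset_ball (by linarith)
  have hZL : Zb w c R ≤ Zb w c (R + ℓ) := by
    unfold Zb
    exact setIntegral_mono_set izd.integrableOn (ae_of_all _ fun x => sq_nonneg _) (Eventually.of_forall hsub)
  have hWL : Wb w c R ≤ Wb w c (R + ℓ) := by
    unfold Wb
    exact setIntegral_mono_set iwd.integrableOn (ae_of_all _ fun x => frobeniusNormSq_nonneg _) (Eventually.of_forall hsub)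
  have hZL0 : 0 ≤ Zb w c (R + ℓ) - Zb w c R := by linarith only [hZL]
  have hWL0 : 0 ≤ Wb w c (R + ℓ) - Wb w c R := by linarith only [hWL]
  have hj₁0 : 0 ≤ j₁ := (integral_nonneg fun x => sq_nonneg _).trans hj₁
  have hj₂0 : 0 ≤ j₂ := (integral_nonneg fun x => sq_nonneg _).trans hj₂
  have hA₁ : 0 ≤ A₁ := (norm_nonneg _).trans (hDw 0)
  exact excess_algebra (le_of_lt kStar_pos) hm hm₃ ht hZb0 hWb0 (by positivity) (by positivity) hsharp hZ hW
    (by linarith only [hJ])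

end Excess

end Summit.NavierStokesRegularity.NavierStokesRegularity.Theorems.NearExtremalTransiencePerFlow.TwoThirds

end
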